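import Literature.AlgebraicGeometry.Resolution.BlowupsRelativeCartier
import Literature.AlgebraicGeometry.Limits.IdealSheafExtension
import Mathlib.RingTheory.Localization.BaseChange
import HarnessLib

/-!
# Inclusions of ideal sheaves spread out from the generic fibre

Topic: `Literature/AlgebraicGeometry/Resolution`. A spreading-out lemma for the
large-characteristic resolution statements (`SpreadsShapedFromGenericPoint`,
`CanonicalResolutionSpread.lean`): let `A` be a domain with fraction field `K`, `q : X → Spec A`
a quasi-compact scheme over `A` with Noetherian affine pieces (e.g. `X` of finite type over a
Noetherian `A`), and `X_K = X ×_{Spec A} Spec K → X` its generic fibre. If two ideal sheaves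
`𝓘, 𝓙` on `X` satisfy `𝓘 · 𝒪_{X_K} ⊆ 𝓙 · 𝒪_{X_K}`, then `𝓘 ⊆ 𝓙` over a neighbourhood
`q⁻¹ D(a)`, `a ≠ 0`, of the generic fibre (EGA IV₃ 8.6 / 9.6 in the elementary form needed:
finitely many generators on finitely many affine charts acquire denominators in `A ∖ 0`).
Equalities and the condition `𝓘 = 𝒪` spread likewise. Everything is PROVED:

* `exists_forall_algebraMap_mul_mem_of_map_le_map` — the algebra: for ideals `I₀, J₀` of an
  `A`-algebra `R` with `I₀` finitely generated and `I₀ · (R ⊗_A K) ⊆ J₀ · (R ⊗_A K)`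
  (`R ⊗_A K` is the localization of `R` at the non-zero elements of `A`), there is `a ≠ 0` in
  `A` with `a · I₀ ⊆ J₀`;
* `map_ideal_comap_fst_specTensorChart` — on the affine chart `Spec (Γ(X, W) ⊗_A E)` of
  `X ×_{Spec A} Spec E` over an affine open `W ⊆ X` (`specTensorChart`,
  `CompletedPullbackRegular.lean`), the section ideal of `𝓚 · 𝒪` corresponds to the extended
  ideal `𝓚(W) · (Γ(X, W) ⊗_A E)`;
* `basicOpen_algebraMap_eq` — `D(a|_W) = W ∩ q⁻¹ D(a)` for the `A`-algebra structure of
  `Γ(X, W)` given by `q`;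
* `exists_comap_ι_le_comap_ι_of_generic` — **the inclusion spreads**:
  `𝓘|_{q⁻¹ D(a)} ⊆ 𝓙|_{q⁻¹ D(a)}` for some `a ≠ 0`; `exists_comap_ι_eq_comap_ι_of_generic`
  (equality), `exists_comap_ι_eq_top_of_generic` (`𝓘 · 𝒪_{X_K} = 𝒪 ⇒ 𝓘|_{q⁻¹ D(a)} = 𝒪`).

## Sources

* A. Grothendieck, EGA IV₃ (Publ. Math. IHÉS 28, 1966), §8.6, §9.6 (spreading out of closed
  subschemes and of inclusions between them). [folklore]
* U. Görtz, T. Wedhorn, *Algebraic Geometry I*, 2nd ed. (2020), Prop. 10.75, Thm. 10.57.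
  [GortzWedhorn2020]
-/

noncomputable section

open CategoryTheory CategoryTheory.Limits AlgebraicGeometry TopologicalSpace TensorProduct

namespace Literature.AlgebraicGeometry.Resolution

universe u

/-! ## The algebra: denominators for finitely many generators -/

section Algebra

variable {A : Type u} [CommRing A] [IsDomain A] {R : Type u} [CommRing R] [Algebra A R]
  (K : Type u) [Field K] [Algebra A K] [IsFractionRing A K]

/-- **A denominator for one element**: if `b ⊗ 1 ∈ J₀ · (R ⊗_A K)` then `a · b ∈ J₀` for some
`a ≠ 0` in `A` (`R ⊗_A K` is the localization of `R` at the image of `A ∖ 0`, Mathlib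
`IsLocalization.tensor`). [folklore] -/
theorem exists_algebraMap_mul_mem_of_tmul_mem_map (J₀ : Ideal R) {b : R}
    (h : (b ⊗ₜ[A] (1 : K) : R ⊗[A] K) ∈
      J₀.map (Algebra.TensorProduct.includeLeftRingHom (R := A) (A := R) (B := K))) :
    ∃ a : A, a ≠ 0 ∧ algebraMap A R a * b ∈ J₀ := by
  set M : Submonoid R := Algebra.algebraMapSubmonoid R (nonZeroDivisors A) with hM
  haveI : IsLocalization M (R ⊗[A] K) := inferInstance
  have halg : (algebraMap R (R ⊗[A] K) : R →+* R ⊗[A] K) =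
      Algebra.TensorProduct.includeLeftRingHom := by
    ext r
    rfl
  have hb : algebraMap R (R ⊗[A] K) b ∈ J₀.map (algebraMap R (R ⊗[A] K)) := by
    rw [halg]
    exact h
  obtain ⟨⟨⟨z, hz⟩, ⟨m, hm⟩⟩, hzm⟩ := (IsLocalization.mem_map_algebraMap_iff M (R ⊗[A] K)).mp hb
  -- `b m = z` in `R ⊗ K`, hence `m' (b m - z) = 0` in `R` for some `m' ∈ M`
  have h0 : algebraMap R (R ⊗[A] K) (b * m - z) = 0 := by
    rw [map_sub, map_mul, sub_eq_zero]
    exact hzm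
  obtain ⟨⟨m', hm'⟩, hm'0⟩ := (IsLocalization.map_eq_zero_iff M (R ⊗[A] K) _).mp h0
  obtain ⟨s, hs, rfl⟩ := Submonoid.mem_map.mp hm
  obtain ⟨s', hs', rfl⟩ := Submonoid.mem_map.mp hm'
  refine ⟨s' * s, mul_ne_zero (nonZeroDivisors.ne_zero hs') (nonZeroDivisors.ne_zero hs), ?_⟩
  have key : algebraMap A R s' * (b * algebraMap A R s - z) = 0 := by
    simpa using hm'0
  rw [mul_sub, sub_eq_zero] at key
  have : algebraMap A R (s' * s) * b = algebraMap A R s' * z := by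
    rw [map_mul, ← key]; ring
  rw [this]
  exact J₀.mul_mem_left _ hz

/-- **Denominators for an inclusion of extended ideals**: let `R` be an `A`-algebra (`A` a
domain with fraction field `K`) and `I₀, J₀` ideals of `R` with `I₀` finitely generated. If
`I₀ · (R ⊗_A K) ⊆ J₀ · (R ⊗_A K)` then `a · I₀ ⊆ J₀` for some `a ≠ 0` in `A` (each of the
finitely many generators picks up a denominator). [folklore] -/
theorem exists_forall_algebraMap_mul_mem_of_map_le_map (I₀ J₀ : Ideal R) (hI : I₀.FG)
    (h : I₀.map (Algebra.TensorProduct.includeLeftRingHom (R := A) (A := R) (B := K)) ≤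
      J₀.map (Algebra.TensorProduct.includeLeftRingHom (R := A) (A := R) (B := K))) :
    ∃ a : A, a ≠ 0 ∧ ∀ b ∈ I₀, algebraMap A R a * b ∈ J₀ := by
  classical
  obtain ⟨G, hG⟩ := hI
  have hgen : ∀ g ∈ G, ∃ a : A, a ≠ 0 ∧ algebraMap A R a * g ∈ J₀ := fun g hg => by
    refine exists_algebraMap_mul_mem_of_tmul_mem_map K J₀ (h ?_)
    exact Ideal.mem_map_of_mem _ (hG ▸ Ideal.subset_span hg)
  choose! a ha0 ha using hgen
  refine ⟨∏ g ∈ G, a g, Finset.prod_ne_zero_iff.mpr fun g hg => ha0 g hg, fun b hb => ?_⟩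
  -- the set of `b` with `(∏ a_g) b ∈ J₀` is an ideal containing the generators
  have hle : I₀ ≤ J₀.colon (Ideal.span {algebraMap A R (∏ g ∈ G, a g)}) := by
    rw [← hG, Ideal.span_le]
    intro g hg
    rw [SetLike.mem_coe, Submodule.mem_colon_span_singleton, smul_eq_mul,
      ← Finset.prod_erase_mul G a hg, map_mul]
    have e : g * (algebraMap A R (∏ x ∈ G.erase g, a x) * algebraMap A R (a g)) =
        algebraMap A R (∏ x ∈ G.erase g, a x) * (algebraMap A R (a g) * g) := by ring
    rw [e]
    exact J₀.mul_mem_left _ (ha g hg)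
  have hb' := hle hb
  rw [Submodule.mem_colon_span_singleton, smul_eq_mul] at hb'
  rw [mul_comm]
  exact hb'

end Algebra

/-! ## The affine chart of a base change over an affine open, and ideal sheaves -/

section Chart

variable {A : Type u} (E : Type u) [CommRing A] [CommRing E] [Algebra A E] {X : Scheme.{u}}
  (q : X ⟶ Spec (.of A)) (W : X.affineOpens) [Algebra A Γ(X, W)]
  (hi : W.2.fromSpec ≫ q = Spec.map (CommRingCat.ofHom (algebraMap A Γ(X, W))))

/-- The chart `Spec (Γ(X, W) ⊗_A E) → X ×_{Spec A} Spec E` covers exactly the preimage of `W`.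
[folklore] -/
theorem image_top_specTensorChart :
    specTensorChart E q W.2.fromSpec hi ''ᵁ ⊤ =
      pullback.fst q (specOfAlgebra A E) ⁻¹ᵁ (W : X.Opens) := by
  rw [Scheme.Hom.image_top_eq_opensRange]
  apply Opens.ext
  rw [Scheme.Hom.coe_opensRange, range_specTensorChart, IsAffineOpen.range_fromSpec]
  rfl

/-- The chart's image is an affine open of the fibre product. [folklore] -/
theorem isAffineOpen_image_top_specTensorChart :
    IsAffineOpen (specTensorChart E q W.2.fromSpec hi ''ᵁ ⊤) :=
  (isAffineOpen_top _).image_of_isOpenImmersion _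

/-- **Sections over the chart**: under `Γ(X ×_A Spec E, chart) ≅ Γ(X, W) ⊗_A E` (the chart's
`appIso` followed by `ΓSpecIso`), the pull-back of a section `b ∈ Γ(X, W)` along the first
projection is `b ⊗ 1`. [folklore] -/
theorem appIso_ΓSpecIso_appLE_eq_tmul (b : Γ(X, W)) :
    (Scheme.ΓSpecIso (.of (Γ(X, W) ⊗[A] E))).hom
      (((specTensorChart E q W.2.fromSpec hi).appIso ⊤).hom
        ((pullback.fst q (specOfAlgebra A E)).appLE W
          (specTensorChart E q W.2.fromSpec hi ''ᵁ ⊤)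
          (image_top_specTensorChart E q W hi).le b)) = b ⊗ₜ[A] (1 : E) := by
  let ψ : Γ(X, W) ⟶ CommRingCat.of (Γ(X, W) ⊗[A] E) :=
    CommRingCat.ofHom (Algebra.TensorProduct.includeLeftRingHom (R := A) (A := Γ(X, W)) (B := E))
  have hcfst : specTensorChart E q W.2.fromSpec hi ≫ pullback.fst q (specOfAlgebra A E) =
      Spec.map ψ ≫ W.2.fromSpec := specTensorChart_fst E q W.2.fromSpec hi
  have key : ((specTensorChart E q W.2.fromSpec hi).appIso ⊤).hom
      ((pullback.fst q (specOfAlgebra A E)).appLE W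
        (specTensorChart E q W.2.fromSpec hi ''ᵁ ⊤) (image_top_specTensorChart E q W hi).le b) =
      (Scheme.ΓSpecIso (.of (Γ(X, W) ⊗[A] E))).inv (b ⊗ₜ[A] (1 : E)) := by
    rw [Scheme.Hom.appIso_hom', ← CommRingCat.comp_apply, Scheme.Hom.appLE_comp_appLE,
      appLE_top_of_eq_SpecMap_comp_fromSpec W ψ _ hcfst, CommRingCat.comp_apply]
    rfl
  rw [key, ← CommRingCat.comp_apply, Iso.inv_hom_id]
  rfl

/-- **The section ideal of a pulled-back ideal sheaf over the chart is the extended ideal**: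
under `Γ(X ×_A Spec E, chart) ≅ Γ(X, W) ⊗_A E`, `(𝓚 · 𝒪)(chart)` corresponds to
`𝓚(W) · (Γ(X, W) ⊗_A E)`. [folklore] -/
theorem map_ideal_comap_fst_specTensorChart (K : X.IdealSheafData) :
    ((K.comap (pullback.fst q (specOfAlgebra A E))).ideal
        ⟨_, isAffineOpen_image_top_specTensorChart E q W hi⟩).map
      ((((specTensorChart E q W.2.fromSpec hi).appIso ⊤) ≪≫
        Scheme.ΓSpecIso (.of (Γ(X, W) ⊗[A] E))).hom.hom) =
      (K.ideal W).map (Algebra.TensorProduct.includeLeftRingHom (R := A) (A := Γ(X, W)) (B := E)) := by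
  rw [ideal_comap_of_le (pullback.fst q (specOfAlgebra A E)) K W
      ⟨_, isAffineOpen_image_top_specTensorChart E q W hi⟩ (image_top_specTensorChart E q W hi).le,
    Ideal.map_map]
  congr 1
  ext b
  change (Scheme.ΓSpecIso (.of (Γ(X, W) ⊗[A] E))).hom
      (((specTensorChart E q W.2.fromSpec hi).appIso ⊤).hom
        ((pullback.fst q (specOfAlgebra A E)).appLE W
          (specTensorChart E q W.2.fromSpec hi ''ᵁ ⊤) _ b)) = b ⊗ₜ[A] (1 : E)
  exact appIso_ΓSpecIso_appLE_eq_tmul E q W hi b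

/-- **Inclusions of pulled-back ideal sheaves over the chart are inclusions of extended
ideals.** [folklore] -/
theorem map_le_map_of_comap_fst_le {I J : X.IdealSheafData}
    (h : (I.comap (pullback.fst q (specOfAlgebra A E))).ideal
        ⟨_, isAffineOpen_image_top_specTensorChart E q W hi⟩ ≤
      (J.comap (pullback.fst q (specOfAlgebra A E))).ideal
        ⟨_, isAffineOpen_image_top_specTensorChart E q W hi⟩) :
    (I.ideal W).map (Algebra.TensorProduct.includeLeftRingHom (R := A) (A := Γ(X, W)) (B := E)) ≤
      (J.ideal W).map (Algebra.TensorProduct.includeLeftRingHom (R := A) (A := Γ(X, W)) (B := E)) := by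
  rw [← map_ideal_comap_fst_specTensorChart E q W hi I, ← map_ideal_comap_fst_specTensorChart E q W hi J]
  exact Ideal.map_mono h

omit [Algebra A E] in
include hi in
/-- **`D(a|_W) = W ∩ q⁻¹ D(a)`** for the `A`-algebra structure of `Γ(X, W)` induced by `q`
(`Spec Γ(X, W) → X → Spec A` is `Spec` of the structure map). [folklore] -/
theorem basicOpen_algebraMap_eq (a : A) :
    X.basicOpen (algebraMap A Γ(X, W) a) = (W : X.Opens) ⊓ q ⁻¹ᵁ (PrimeSpectrum.basicOpen a) := by
  -- both opens lie in `W`, the range of the open immersion `W.fromSpec`; compare preimages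
  have h1 : W.2.fromSpec ⁻¹ᵁ X.basicOpen (algebraMap A Γ(X, W) a) =
      PrimeSpectrum.basicOpen (algebraMap A Γ(X, W) a) := W.2.fromSpec_preimage_basicOpen _
  have e3 : Spec.map (CommRingCat.ofHom (algebraMap A Γ(X, W))) ⁻¹ᵁ PrimeSpectrum.basicOpen a =
      PrimeSpectrum.basicOpen (algebraMap A Γ(X, W) a) := by
    ext x
    change Spec.map (CommRingCat.ofHom (algebraMap A Γ(X, W))) x ∈ PrimeSpectrum.basicOpen a ↔
      x ∈ PrimeSpectrum.basicOpen (algebraMap A Γ(X, W) a)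
    exact Iff.rfl
  have h2 : W.2.fromSpec ⁻¹ᵁ ((W : X.Opens) ⊓ q ⁻¹ᵁ (PrimeSpectrum.basicOpen a)) =
      PrimeSpectrum.basicOpen (algebraMap A Γ(X, W) a) := by
    rw [Scheme.Hom.preimage_inf, IsAffineOpen.fromSpec_preimage_self, top_inf_eq,
      ← Scheme.Hom.comp_preimage, hi, e3]
  have e1 := (W.2.fromSpec).image_preimage_eq_opensRange_inf (X.basicOpen (algebraMap A Γ(X, W) a))
  have e2 := (W.2.fromSpec).image_preimage_eq_opensRange_inf
    ((W : X.Opens) ⊓ q ⁻¹ᵁ (PrimeSpectrum.basicOpen a))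
  rw [h1] at e1
  rw [h2] at e2
  rw [IsAffineOpen.opensRange_fromSpec, inf_eq_right.mpr (X.basicOpen_le _)] at e1
  rw [IsAffineOpen.opensRange_fromSpec, inf_eq_right.mpr inf_le_left] at e2
  rw [← e1, ← e2]

end Chart

/-! ## Spreading out inclusions of ideal sheaves -/

section Spread

variable {A : Type u} [CommRing A] [IsDomain A] (K : Type u) [Field K] [Algebra A K]
  [IsFractionRing A K] {X : Scheme.{u}} [CompactSpace X] [IsLocallyNoetherian X]
  (q : X ⟶ Spec (.of A))

omit [CompactSpace X] in
/-- **On one affine open**: if `𝓘 · 𝒪_{X_K} ⊆ 𝓙 · 𝒪_{X_K}` then, for the `A`-algebra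
structure of `Γ(X, W)` induced by `q`, `𝓘 ⊆ 𝓙` on the basic open `D(a|_W) = W ∩ q⁻¹ D(a)`
for some `a ≠ 0`. [folklore] -/
theorem exists_ideal_affineBasicOpen_le_of_generic (I J : X.IdealSheafData)
    (h : I.comap (pullback.fst q (specOfAlgebra A K)) ≤ J.comap (pullback.fst q (specOfAlgebra A K)))
    (W : X.affineOpens) [Algebra A Γ(X, W)]
    (hi : W.2.fromSpec ≫ q = Spec.map (CommRingCat.ofHom (algebraMap A Γ(X, W)))) :
    ∃ a : A, a ≠ 0 ∧ I.ideal (X.affineBasicOpen (algebraMap A Γ(X, W) a)) ≤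
      J.ideal (X.affineBasicOpen (algebraMap A Γ(X, W) a)) := by
  haveI : IsNoetherianRing Γ(X, W) := IsLocallyNoetherian.component_noetherian W
  obtain ⟨a, ha0, ha⟩ := exists_forall_algebraMap_mul_mem_of_map_le_map K (I.ideal W) (J.ideal W)
    (IsNoetherian.noetherian _) (map_le_map_of_comap_fst_le K q W hi (h _))
  refine ⟨a, ha0, ?_⟩
  haveI := W.2.isLocalization_basicOpen (algebraMap A Γ(X, W) a)
  rw [Limits.ideal_affineBasicOpen_eq_map, Limits.ideal_affineBasicOpen_eq_map]
  refine Ideal.span_le.mpr ?_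
  rintro _ ⟨b, hb, rfl⟩
  rw [SetLike.mem_coe]
  have hunit : IsUnit (algebraMap Γ(X, W) Γ(X, X.basicOpen (algebraMap A Γ(X, W) a))
      (algebraMap A Γ(X, W) a)) := IsLocalization.Away.algebraMap_isUnit _
  have hmem : algebraMap Γ(X, W) Γ(X, X.basicOpen (algebraMap A Γ(X, W) a))
      (algebraMap A Γ(X, W) a * b) ∈
        (J.ideal W).map (algebraMap Γ(X, W) Γ(X, X.basicOpen (algebraMap A Γ(X, W) a))) :=
    Ideal.mem_map_of_mem _ (ha b hb)
  rw [map_mul] at hmem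
  exact (Ideal.unit_mul_mem_iff_mem _ hunit).mp hmem

/-- **Inclusions of ideal sheaves spread out from the generic fibre** (EGA IV₃ 8.6 / 9.6 in
elementary form): let `A` be a domain with fraction field `K`, `q : X → Spec A` quasi-compact
and locally Noetherian, `X_K = X ×_{Spec A} Spec K` (Mathlib's chosen fibre product). If
`𝓘 · 𝒪_{X_K} ⊆ 𝓙 · 𝒪_{X_K}` then `𝓘|_{q⁻¹ D(a)} ⊆ 𝓙|_{q⁻¹ D(a)}` for some `a ≠ 0` in `A`
(finitely many affine charts; on each, denominators for the finitely many generators of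
`𝓘(W)`, `exists_forall_algebraMap_mul_mem_of_map_le_map`; then `D(a|_W) = W ∩ q⁻¹ D(a)` and
locality of inclusions, `Limits.ideal_le_ideal_of_le_iSup`). [folklore] -/
theorem exists_comap_ι_le_comap_ι_of_generic (I J : X.IdealSheafData)
    (h : I.comap (pullback.fst q (specOfAlgebra A K)) ≤ J.comap (pullback.fst q (specOfAlgebra A K))) :
    ∃ a : A, a ≠ 0 ∧
      I.comap (q ⁻¹ᵁ (PrimeSpectrum.basicOpen a)).ι ≤ J.comap (q ⁻¹ᵁ (PrimeSpectrum.basicOpen a)).ι := by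
  classical
  obtain ⟨t, ht⟩ := Limits.exists_finset_affineOpens_iSup_eq_top X
  -- the `A`-algebra structures of the `Γ(X, W)`
  let φ : ∀ W : X.affineOpens, CommRingCat.of A ⟶ Γ(X, W) := fun W => Spec.preimage (W.2.fromSpec ≫ q)
  have hW : ∀ W : X.affineOpens, ∃ a : A, a ≠ 0 ∧
      I.ideal (X.affineBasicOpen ((φ W).hom a)) ≤ J.ideal (X.affineBasicOpen ((φ W).hom a)) := by
    intro W
    letI : Algebra A Γ(X, W) := (φ W).hom.toAlgebra
    have hi : W.2.fromSpec ≫ q = Spec.map (CommRingCat.ofHom (algebraMap A Γ(X, W))) := by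
      rw [RingHom.algebraMap_toAlgebra, CommRingCat.ofHom_hom, Spec.map_preimage]
    exact exists_ideal_affineBasicOpen_le_of_generic K q I J h W hi
  choose a ha0 ha using hW
  refine ⟨∏ W ∈ t, a W, Finset.prod_ne_zero_iff.mpr fun W _ => ha0 W, ?_⟩
  set U : X.Opens := q ⁻¹ᵁ (PrimeSpectrum.basicOpen (∏ W ∈ t, a W)) with hU
  -- `D(a_W|_W) ⊇ W ∩ U` for `W ∈ t`
  have hbasic : ∀ W ∈ t, (W : X.Opens) ⊓ U ≤ X.basicOpen ((φ W).hom (a W)) := by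
    intro W hWt
    letI : Algebra A Γ(X, W) := (φ W).hom.toAlgebra
    have hi : W.2.fromSpec ≫ q = Spec.map (CommRingCat.ofHom (algebraMap A Γ(X, W))) := by
      rw [RingHom.algebraMap_toAlgebra, CommRingCat.ofHom_hom, Spec.map_preimage]
    have e := basicOpen_algebraMap_eq q W hi (a W)
    rw [RingHom.algebraMap_toAlgebra] at e
    rw [e]
    refine inf_le_inf_left _ (Scheme.Hom.preimage_mono _ ?_)
    rw [← Finset.prod_erase_mul t a hWt, PrimeSpectrum.basicOpen_mul]
    exact inf_le_right
  -- inclusion on every affine open inside `U`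
  refine Limits.comap_ι_le_of_forall_ideal_le fun V hV => ?_
  refine Limits.ideal_le_ideal_of_le_iSup I J (fun W : t => (W : X.Opens) ⊓ U) ?_ V ?_
  · intro W V' hV'
    have hV'D : (V' : X.Opens) ≤ X.affineBasicOpen ((φ W).hom (a W)) :=
      hV'.trans (hbasic W W.2)
    rw [← I.map_ideal hV'D, ← J.map_ideal hV'D]
    exact Ideal.map_mono (ha W)
  · intro x hx
    have hxt : x ∈ (⊤ : X.Opens) := trivial
    have hx' := ht hxt
    obtain ⟨W, hW⟩ := Opens.mem_iSup.mp hx'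
    obtain ⟨hWt, hxW⟩ := Opens.mem_iSup.mp hW
    exact Opens.mem_iSup.mpr ⟨⟨W, hWt⟩, ⟨hxW, hV hx⟩⟩

/-- **Equalities of ideal sheaves spread out from the generic fibre.** [folklore] -/
theorem exists_comap_ι_eq_comap_ι_of_generic (I J : X.IdealSheafData)
    (h : I.comap (pullback.fst q (specOfAlgebra A K)) = J.comap (pullback.fst q (specOfAlgebra A K))) :
    ∃ a : A, a ≠ 0 ∧
      I.comap (q ⁻¹ᵁ (PrimeSpectrum.basicOpen a)).ι = J.comap (q ⁻¹ᵁ (PrimeSpectrum.basicOpen a)).ι := by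
  obtain ⟨a₁, h₁0, h₁⟩ := exists_comap_ι_le_comap_ι_of_generic K q I J h.le
  obtain ⟨a₂, h₂0, h₂⟩ := exists_comap_ι_le_comap_ι_of_generic K q J I h.ge
  -- restricting an inclusion of restrictions to a smaller open
  have restr : ∀ {I' J' : X.IdealSheafData} {U U' : X.Opens}, U ≤ U' →
      I'.comap U'.ι ≤ J'.comap U'.ι → I'.comap U.ι ≤ J'.comap U.ι := by
    intro I' J' U U' hUU' h'
    rw [← X.homOfLE_ι hUU', Scheme.IdealSheafData.comap_comp, Scheme.IdealSheafData.comap_comp]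
    exact Scheme.IdealSheafData.comap_mono _ h'
  refine ⟨a₁ * a₂, mul_ne_zero h₁0 h₂0, le_antisymm ?_ ?_⟩
  · refine restr (Scheme.Hom.preimage_mono _ ?_) h₁
    rw [PrimeSpectrum.basicOpen_mul]
    exact inf_le_left
  · refine restr (Scheme.Hom.preimage_mono _ ?_) h₂
    rw [PrimeSpectrum.basicOpen_mul]
    exact inf_le_right

/-- **The condition `𝓘 = 𝒪` spreads out from the generic fibre**: if `𝓘 · 𝒪_{X_K} = 𝒪_{X_K}`
then `𝓘|_{q⁻¹ D(a)} = 𝒪` for some `a ≠ 0`. [folklore] -/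
theorem exists_comap_ι_eq_top_of_generic (I : X.IdealSheafData)
    (h : I.comap (pullback.fst q (specOfAlgebra A K)) = ⊤) :
    ∃ a : A, a ≠ 0 ∧ I.comap (q ⁻¹ᵁ (PrimeSpectrum.basicOpen a)).ι = ⊤ := by
  obtain ⟨a, ha0, ha⟩ := exists_comap_ι_le_comap_ι_of_generic K q ⊤ I
    (by rw [Scheme.IdealSheafData.comap_top, h])
  refine ⟨a, ha0, top_le_iff.mp ?_⟩
  rwa [Scheme.IdealSheafData.comap_top] at ha

end Spread

end Literature.AlgebraicGeometry.Resolution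

end
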